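import Literature.Computability.QuantumComplexity.OversamplingClosure
import Literature.Analysis.Matrix.HoffmanWielandt
import HarnessLib

/-!
# Eigenvalue transformations of the Gram matrix are stable under row sketching
# (CGLLTW 2022, §5.3: the Frobenius-norm case of the step `‖f(R†R) − f(A†A)‖ ≲ ε`)

Chia, Gilyén, Li, Lin, Tang, Wang, J. ACM 69(5):33 (2022) = arXiv:1910.06151, **§5.3 "Singular
value transformation"**, proof of the main theorem on *even singular value transformation*
(`thm:evenSing`; held arXiv text p. 37). With `R = SA` the importance-sampling row sketch of `A`
drawn from `SQ_φ(A)`, the third step of that proof reads (norm `‖·‖_*` = Frobenius or spectral):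

> • `‖f(R†R) − f(A†A)‖_* ≤ ε/2`. We need the polylog factors in our number of samples to deal
>   with the […] that arises from (lemma:lipschitz) in the spectral norm case.
>   `‖f(R†R) − f(A†A)‖_* ≲ L‖R†R − A†A‖_* […]`     ((lemma:lipschitz) or (lem:lipschitz-frob))
>   `≲ L √(φ² log(1/δ)/r) […] ‖A‖_* ‖A‖_F […]`    ((lem:AMP-spectral) or (prop:appr-mms))
>   `≲ ε.`

Here `[…]` marks factors that belong to the SPECTRAL-norm branch only — the operator-Lipschitz
factor of Lemma 5.5/5.6 after `‖R†R − A†A‖_*` on the first line and polylogarithmic-in-`r` tokens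
on the second (both macro-stripped in the held tex chunk, p. 37 L105–116, so their exact printed
form is not reproduced here; referee R-SET-1).  For the Frobenius norm, which is the case this file
formalises, those factors are absent and the chain reads
`‖f(R†R) − f(A†A)‖_F ≤ L‖R†R − A†A‖_F ≲ L √(φ² log(1/δ)/r) ‖A‖_F²`,
where (lem:lipschitz-frob) is **Lemma 5.4** ([Gil10]: for Hermitian
`A, B` and `f` `L`-Lipschitz on their eigenvalues, `‖f(A) − f(B)‖_F ≤ L‖A − B‖_F`) and
(prop:appr-mms) is the §3.2 key lemma "Approximating matrix multiplication".

This file proves exactly this Frobenius-norm chain as a finite-probability statement, composing the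
tree's `Literature.Analysis.Matrix.HoffmanWielandt.frobNorm_cfc_sub_cfc_le` (Lemma 5.4, via
Mathlib's matrix continuous functional calculus `cfc`) with
`SampleQuery.approx_matrix_product'` (the key lemma in its `log(1/δ)` form, `X = Y = A`,
`p = q = 𝒟_ã` from `SQ_φ(A)` — `OversamplingClosure.isOversampledDist_rowDist`):

* (private) `frobSqNorm_eq_frobSq`: the bridge between the two squared Frobenius norms of the tree
  (`HoffmanWielandt.frobSqNorm`, any `RCLike` field, here `ℝ`; and `SampleQuery.frobSq`).
* `frobNorm_cfc_gram_sub_le` (deterministic, Lemma 5.4 on Gram matrices): for real `B` (`s×n`),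
  `A` (`m×n`) and `f` with `|f x − f y| ≤ L|x − y|` on `[0,∞)` (the Gram matrices are positive
  semidefinite, so this covers "Lipschitz on the eigenvalues"),
  `‖f(BᵀB) − f(AᵀA)‖_F ≤ L‖BᵀB − AᵀA‖_F`.
* `sketch_eigenvalueTransform_stable`: for `SQ_φ(A)`, `A ≠ 0`, `s ≥ 1` rows and every `δ > 0`, the
  `𝒟_ã`-mass of the sample sequences `ω` with
  `‖f((S_ωA)ᵀ(S_ωA)) − f(AᵀA)‖_F ≤ L √(8φ² log(2/δ)/s) ‖A‖_F²` exceeds `1 − δ`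
  (so `s ≥ 8φ²L²‖A‖_F⁴ log(2/δ)/ε²` rows give error `≤ ε` with probability `> 1 − δ` — the
  printed `r = Ω̃(φ² L² ‖A‖⁴‖A‖_F² ε⁻² log(1/δ))` with `‖A‖` replaced by `‖A‖_F`, as befits the
  Frobenius variant).

Not formalized here: the spectral-norm variant (Lemmas 5.5–5.7, operator-Lipschitz estimates with
their `log` factors, and the matrix-Bernstein sketch bound (lem:AMP-spectral)); the remaining steps
of the even-SVT theorem (the column sketch `C = SAT`, `f(CC†)` versus `f(RR†)`, and the final
sampling access to `R† f̄(CC†) R`).  Real entries as in the rest of the toolbox.  No named facts are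
introduced; everything stated is proved.

## References
* [ChiaEtAl2022] N.-H. Chia, A. Gilyén, T. Li, H.-H. Lin, E. Tang, C. Wang, J. ACM 69(5):33, 2022
  (= arXiv:1910.06151), §5.3 Lemma 5.4 and the proof of the even singular value transformation
  theorem, third bullet (held text p. 37 L55–57, L91–106).
* [HornJohnson2013] R. A. Horn, C. R. Johnson, *Matrix Analysis*, 2nd ed., Thm 6.3.5 (proof) — via
  `Literature.Analysis.Matrix.HoffmanWielandt`.
-/

noncomputable section

open scoped Matrix

namespace Literature.Computability.QuantumComplexity

namespace SampleQuery

open Finset Literature.Analysis.Matrix.HoffmanWielandt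

variable {m n s : ℕ} {φ : ℝ} {A : Matrix (Fin m) (Fin n) ℝ}

/-- Bridge: for a real square matrix the squared Frobenius norm `Σ_ij ‖M_ij‖²` of
`HoffmanWielandt.frobSqNorm` is the toolbox's `frobSq M = Σ_ij M_ij²`. `[folklore]` (private plumbing) -/
private theorem frobSqNorm_eq_frobSq (M : Matrix (Fin n) (Fin n) ℝ) : frobSqNorm M = frobSq M := by
  rw [frobSq_eq_sum_sq]
  unfold frobSqNorm
  simp only [Real.norm_eq_abs, sq_abs]

/-- A real Gram matrix `BᵀB` is symmetric. `[folklore]` -/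
private theorem gram_isHermitian (B : Matrix (Fin s) (Fin n) ℝ) : (Bᵀ * B).IsHermitian := by
  simpa [Matrix.conjTranspose_eq_transpose_of_trivial] using Matrix.isHermitian_conjTranspose_mul_self B

/-- A real Gram matrix `BᵀB` is positive semidefinite, so its eigenvalues are `≥ 0`. `[folklore]` -/
private theorem gram_eigenvalues_nonneg (B : Matrix (Fin s) (Fin n) ℝ) (i : Fin n) :
    0 ≤ (gram_isHermitian B).eigenvalues i := by
  have h : (Bᵀ * B).PosSemidef := by
    simpa [Matrix.conjTranspose_eq_transpose_of_trivial] using Matrix.posSemidef_conjTranspose_mul_self B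
  exact h.eigenvalues_nonneg i

/-- **Lemma 5.4 on Gram matrices** (deterministic): for real `B ∈ ℝ^{s×n}`, `A ∈ ℝ^{m×n}` and
`f : ℝ → ℝ` with `|f(x) − f(y)| ≤ L|x − y|` for all `x, y ≥ 0` (hence on the eigenvalues of the
positive semidefinite `BᵀB`, `AᵀA`), `‖f(BᵀB) − f(AᵀA)‖_F ≤ L‖BᵀB − AᵀA‖_F`, where
`f(M) = cfc f M` is the eigenvalue transformation `V f(Λ) Vᵀ`.
[cite: ChiaEtAl2022, §5.3 Lemma 5.4 ([Gil10]) and proof of the even-SVT theorem, third bullet,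
first inequality `‖f(R†R) − f(A†A)‖_F ≲ L‖R†R − A†A‖_F`] -/
theorem frobNorm_cfc_gram_sub_le (B : Matrix (Fin s) (Fin n) ℝ) (A : Matrix (Fin m) (Fin n) ℝ)
    (f : ℝ → ℝ) {L : ℝ} (hL0 : 0 ≤ L)
    (hL : ∀ x y : ℝ, 0 ≤ x → 0 ≤ y → |f x - f y| ≤ L * |x - y|) :
    Real.sqrt (frobSq (cfc f (Bᵀ * B) - cfc f (Aᵀ * A))) ≤
      L * Real.sqrt (frobSq (Bᵀ * B - Aᵀ * A)) := by
  rw [← frobSqNorm_eq_frobSq, ← frobSqNorm_eq_frobSq]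
  exact frobNorm_cfc_sub_cfc_le (gram_isHermitian B) (gram_isHermitian A) f hL0
    (fun i j => hL _ _ (gram_eigenvalues_nonneg B i) (gram_eigenvalues_nonneg A j))

/-- **Eigenvalue transformations of `AᵀA` are stable under row sketching** (CGLLTW §5.3, the
Frobenius case of `‖f(R†R) − f(A†A)‖ ≲ ε` with `R = SA`): given `SQ_φ(A)` (`A ≠ 0`), let `S` have
`s ≥ 1` rows sampled according to `𝒟_ã`, and let `f` satisfy `|f(x) − f(y)| ≤ L|x − y|` on
`[0,∞)`, `L ≥ 0`. For every `δ > 0`, with `𝒟_ã`-probability `> 1 − δ` over the sample sequence,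
`‖f((SA)ᵀ(SA)) − f(AᵀA)‖_F ≤ L · √(8φ² log(2/δ)/s) · ‖A‖_F²`.
[cite: ChiaEtAl2022, §5.3 proof of the even-SVT theorem, third bullet, Frobenius norm:
`‖f(R†R) − f(A†A)‖_F ≲ L‖R†R − A†A‖_F ≲ L√(φ² log(1/δ)/r)‖A‖_F² ≲ ε` (Lemma 5.4 with the key lemma
"Approximating matrix multiplication")] -/
theorem sketch_eigenvalueTransform_stable (W : MatrixOversamplingWitness φ A) (hA : A ≠ 0)
    (hs : 0 < s) {δ : ℝ} (hδ : 0 < δ) (f : ℝ → ℝ) {L : ℝ} (hL0 : 0 ≤ L)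
    (hL : ∀ x y : ℝ, 0 ≤ x → 0 ≤ y → |f x - f y| ≤ L * |x - y|) :
    1 - δ < ∑ ω ∈ univ.filter (fun ω : Fin s → Fin m =>
        Real.sqrt (frobSq (cfc f ((sketch (rowDist W.tilde) ω * A)ᵀ * (sketch (rowDist W.tilde) ω * A)) -
            cfc f (Aᵀ * A))) ≤
          L * (Real.sqrt (8 * φ ^ 2 * Real.log (2 / δ) / s) * frobSq A)),
      iidWeight (rowDist W.tilde) ω := by
  classical
  have hp := W.isOversampledDist_rowDist hA
  have hφ := W.pos hA
  -- the key lemma with `X = Y = A`, `p = q = 𝒟_ã` (so `r = (p+q)/2 = 𝒟_ã`)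
  have hkey := approx_matrix_product' hp hp hφ hφ hA hA hs hδ
  have havg : (fun k => (rowDist W.tilde k + rowDist W.tilde k) / 2) = rowDist W.tilde :=
    funext fun k => by ring
  rw [havg] at hkey
  have hthr : Real.sqrt (8 * φ * φ * Real.log (2 / δ) / s) *
      (Real.sqrt (frobSq A) * Real.sqrt (frobSq A)) =
      Real.sqrt (8 * φ ^ 2 * Real.log (2 / δ) / s) * frobSq A := by
    rw [Real.mul_self_sqrt (frobSq_nonneg A), sq, ← mul_assoc]
  rw [hthr] at hkey
  -- the Frobenius event implies the eigenvalue-transformation event (Lemma 5.4)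
  refine lt_of_lt_of_le hkey (sum_le_sum_of_subset_of_nonneg ?_ fun ω _ _ =>
    iidWeight_nonneg hp.nonneg ω)
  intro ω hω
  simp only [mem_filter, mem_univ, true_and] at hω ⊢
  exact (frobNorm_cfc_gram_sub_le _ _ f hL0 hL).trans (mul_le_mul_of_nonneg_left hω.le hL0)

end SampleQuery

end Literature.Computability.QuantumComplexity

end
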